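import Summits.BirchSwinnertonDyer.BirchSwinnertonDyer.Theorems.SignedLowerHalvesKobayashiLowerHalfLargeImageParityStratumFE
import Literature.NumberTheory.EllipticCurves.Kobayashi2003.SignedKatoDivisibility
import HarnessLib

/-!
# Route `SignedLowerHalves` (K3), crux 4 `KobayashiMainConjectureSmallImage` (item stmt-BirchSwinnertonDyer-19002):
# the parity stratum at small image, EXACT FORM — at a `(0, ≤ 1)`-certified odd supersingular pair of ANY image,
# `char X^ε = (p^k · ϖ · L_p^ε)` for some `k`: Kobayashi's main conjecture there is EQUIVALENT to `μ(X^ε) = 0`,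
# modulo PRINT ONLY (Kobayashi Thm. 1.2 / 4.1-rational, the period units, `p`-parity)

Cell `bsd-ssimc`, seat `bsd-line-slh-p3` LEAD gen 12 (helper file `--supports stmt-BirchSwinnertonDyer-19002`; CALIBRATION /
SUPPORT ONLY; companion of `…SmallImageParityStratum.lean`, which paid the missing `p`-power with Coates–Sujatha's
Conjecture A). HONEST FRAMING: crux 4 is OPEN; every theorem is CONDITIONAL on DISPLAYED published binders `h12`
(Kobayashi Thm. 1.2), `h41` (Thm. 4.1 — ONLY its first, image-free display `∃ n, pⁿ L_p^ε ∈ Char X^ε` is used), `h5`/`h3`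
(period units), `hpar` (`p`-parity) and ONE per-pair certificate; route-independent (no `Theses` import); THEOREMS ONLY;
BSD / crux 4 NOT proved.

## Why

At a pair with `(μ, λ)(L_p^ε) = (0, 1)`: `(L_p^ε) = (T)` (functional equation + two-coefficient rigidity, slh-p1's
`rootNumber_eq_neg_one_and_X_dvd_of_lam_eq_one`), `T ∣ ξ^ε` by PARITY (`X_dvd_of_charIdeal_eq_span_of_lam_eq_one`, odd
corank), and Kato's RATIONAL inclusion `ξ^ε ∣ pⁿ L_p^ε` (`thm41….exists_dvd_pow_mul`, NO image hypothesis). Pure algebra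
in `Λ = ℤ_p⟦T⟧` (§1: a divisor of `pⁿ·T` divisible by `T` is `p^k·T` up to a unit — `μ`/`pfree` bookkeeping of
`X1.MuLambdaAlgebra`) then gives `(ξ^ε) = (p^k · L_p^ε)`, `k ≤ n`; with `(0, 0)` (`L_p^ε` a unit) the same with
`(ξ^ε) = (p^k)`. So ON THE STRATUM the main conjecture for `ε` holds iff `k = 0` iff `μ(ξ^ε) = 0`: the ONLY input
crux 4 needs there beyond print is the `μ`-invariant of the signed Selmer group (Kobayashi's `μ^± = 0`, implied by
Conjecture A + `μ(L_p^ε) = 0` via the companion file) — not the two-variable engines, not the analytic rider.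

## What is proved

* §1 (algebra in `Λ`) `exists_span_eq_C_pow_of_mul_eq_C_pow` (`ξ₁ · w = p^n ⟹ (ξ₁) = (p^k)`, `k ≤ n`),
  `exists_span_eq_C_pow_mul_of_dvd_of_X_dvd` (`ξ ∣ pⁿ L`, `T ∣ ξ`, `(L) = (T)` ⟹ `(ξ) = (p^k L)`),
  `exists_span_eq_C_pow_mul_of_dvd_of_isUnit` (`ξ ∣ pⁿ L`, `L` a unit ⟹ `(ξ) = (p^k L)`).
* §2 `exists_charIdeal_eq_span_C_pow_mul_of_lam_le_one` — odd good `p`, `a_p = 0`, ANY image, certificate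
  `(μ, λ)(L_p^ε) = (0, ≤ 1)`: for every datum of the binder, `X^ε` is torsion and `char X^ε = (g)` with
  `g^ℚ = ϖ · (p^k · L_p^ε)^ℚ` for some `k` (granted `h12 h41 h5 h3 hpar`).
* §3 `kobayashiMainConjecture_of_lam_le_one_of_mu_eq_zero` — the same plus «`μ(ξ) = 0` for a characteristic power
  series of each datum» ⟹ `KobayashiMainConjecture W p ε`; `mu_eq_zero_of_kobayashiMainConjecture_of_lam_le_one` (converse:
  the main conjecture forces `μ(ξ^ε) = 0` on the stratum); `kobayashiMainConjecture_iff_mu_eq_zero_of_lam_le_one`.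

References: [Kobayashi2003] Thm. 1.2, Thm. 4.1, Conjecture (p. 2), Thm. 1.4; [Pollack2003] Prop. 6.18; [Sprung2017]
Cor. 4.14; [DokchitserDokchitserAnnals2010] Thm. 1.4; [GreenbergVatsal2000] p. 4; [Washington1997] §7.1, §13.2. Tree:
`…LargeImageParityStratum{,FE}` (slh-p1 LEAD g12), `Rank1Residual/X1/MuLambdaAlgebra`, `Supersingular/SignedSqueeze`.
-/

set_option autoImplicit false
set_option linter.dupNamespace false

noncomputable section

open scoped Classical MatrixGroups ModularForm

open CongruenceSubgroup PowerSeries WeierstrassCurve Field Literature.NumberTheory.EllipticCurves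
  Literature.NumberTheory.EllipticCurves.ModularForms
  Literature.NumberTheory.EllipticCurves.Rank1Residual Literature.NumberTheory.EllipticCurves.Sprung2017
  Literature.NumberTheory.EllipticCurves.Kobayashi2003 ZpExtension
  Literature.NumberTheory.EllipticCurves.Rank1Residual.Typed
  Summit.BirchSwinnertonDyer.Rank1Residual.X1.MuLambda
  Summit.BirchSwinnertonDyer.Rank1Residual.Supersingular

namespace Summit.BirchSwinnertonDyer.BirchSwinnertonDyer.Theorems.SmallImageParityStratumExact

/-! ## §1. Algebra in `Λ = ℤ_p⟦T⟧`: divisors of `pⁿ` and of `pⁿ · T` -/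

section Algebra

variable {p : ℕ} [Fact p.Prime]

/-- `μ(p^n) = n` and `pfree(p^n) = 1` in `Λ`. [cite: Washington1997, §7.1] -/
theorem mu_C_pow_and_pfree_C_pow (n : ℕ) :
    mu (C ((p : ℤ_[p]) ^ n) : IwasawaAlgebra p) = n ∧ pfree (C ((p : ℤ_[p]) ^ n) : IwasawaAlgebra p) = 1 := by
  have h1 : red (1 : IwasawaAlgebra p) ≠ 0 := by
    rw [red, map_one]; exact one_ne_zero
  exact mu_eq_and_pfree_eq h1 (by rw [mul_one])

/-- **A divisor of `pⁿ` in `Λ` is `p^k` up to a unit**: `ξ₁ · w = p^n ⟹ (ξ₁) = (p^k)` for some `k ≤ n`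
(`pfree` is multiplicative and `pfree(pⁿ) = 1`, so `pfree ξ₁` is a unit; `k = μ(ξ₁)`). [cite: Washington1997, §7.1] -/
theorem exists_span_eq_C_pow_of_mul_eq_C_pow {ξ₁ w : IwasawaAlgebra p} {n : ℕ}
    (h : ξ₁ * w = C ((p : ℤ_[p]) ^ n)) :
    ∃ k ≤ n, Ideal.span ({ξ₁} : Set (IwasawaAlgebra p)) = Ideal.span {C ((p : ℤ_[p]) ^ k)} := by
  have hprod : ξ₁ * w ≠ 0 := by rw [h]; exact C_pow_ne_zero n
  have hξ₁ : ξ₁ ≠ 0 := left_ne_zero_of_mul hprod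
  have hw : w ≠ 0 := right_ne_zero_of_mul hprod
  obtain ⟨hmu, hpf⟩ := mu_C_pow_and_pfree_C_pow (p := p) n
  have hunit : IsUnit (pfree ξ₁) := by
    refine IsUnit.of_mul_eq_one (pfree w) ?_
    rw [← pfree_mul hξ₁ hw, h, hpf]
  refine ⟨mu ξ₁, ?_, ?_⟩
  · have := mu_le_mu_mul hξ₁ hw
    rwa [h, hmu] at this
  · conv_lhs => rw [eq_C_pow_mu_mul_pfree ξ₁]
    exact Ideal.span_singleton_mul_right_unit hunit _

/-- **A divisor of `pⁿ · L` divisible by `T`, with `(L) = (T)`, is `p^k · L` up to a unit**: `ξ ∣ pⁿ L`, `T ∣ ξ`,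
`(L) = (T)` ⟹ `(ξ) = (p^k · L)` for some `k ≤ n` (cancel `T` in the domain `Λ`, then the previous lemma).
[cite: Washington1997, §7.1] [cite: GreenbergVatsal2000, p. 4] -/
theorem exists_span_eq_C_pow_mul_of_dvd_of_X_dvd {ξ L : IwasawaAlgebra p} {n : ℕ}
    (hdvd : ξ ∣ C ((p : ℤ_[p]) ^ n) * L) (hXξ : (X : IwasawaAlgebra p) ∣ ξ)
    (hLX : Ideal.span ({L} : Set (IwasawaAlgebra p)) = Ideal.span {X}) :
    ∃ k ≤ n, Ideal.span ({ξ} : Set (IwasawaAlgebra p)) = Ideal.span {C ((p : ℤ_[p]) ^ k) * L} := by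
  obtain ⟨v, hv⟩ := Ideal.span_singleton_eq_span_singleton.mp hLX
  obtain ⟨h, hh⟩ := hdvd
  obtain ⟨ξ₁, hξ₁⟩ := hXξ
  have hv' : L * (v : IwasawaAlgebra p) = X := hv
  -- `p^n · X = p^n · L · v = ξ h v = X ξ₁ h v`; cancel `X`
  have key : (X : IwasawaAlgebra p) * (ξ₁ * (h * (v : IwasawaAlgebra p))) = X * C ((p : ℤ_[p]) ^ n) := by
    calc (X : IwasawaAlgebra p) * (ξ₁ * (h * (v : IwasawaAlgebra p)))
        = (ξ * h) * (v : IwasawaAlgebra p) := by rw [hξ₁]; ring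
      _ = C ((p : ℤ_[p]) ^ n) * (L * (v : IwasawaAlgebra p)) := by rw [← hh]; ring
      _ = X * C ((p : ℤ_[p]) ^ n) := by rw [hv']; ring
  have hfac : ξ₁ * (h * (v : IwasawaAlgebra p)) = C ((p : ℤ_[p]) ^ n) := mul_left_cancel₀ X_ne_zero key
  obtain ⟨k, hk, hspan⟩ := exists_span_eq_C_pow_of_mul_eq_C_pow hfac
  refine ⟨k, hk, ?_⟩
  -- `(ξ) = (X ξ₁) = (X p^k) = (L p^k)`
  have hLXa : Associated L (X : IwasawaAlgebra p) := ⟨v, hv⟩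
  have h1 : Associated ξ₁ (C ((p : ℤ_[p]) ^ k)) := Ideal.span_singleton_eq_span_singleton.mp hspan
  apply Ideal.span_singleton_eq_span_singleton.mpr
  rw [hξ₁, mul_comm (C _) L]
  exact (hLXa.symm.mul_mul h1)

/-- **A divisor of `pⁿ · L` with `L` a unit is `p^k · L` up to a unit** (the `λ(L_p^ε) = 0` case). [cite: Washington1997, §7.1] -/
theorem exists_span_eq_C_pow_mul_of_dvd_of_isUnit {ξ L : IwasawaAlgebra p} {n : ℕ}
    (hdvd : ξ ∣ C ((p : ℤ_[p]) ^ n) * L) (hL : IsUnit L) :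
    ∃ k ≤ n, Ideal.span ({ξ} : Set (IwasawaAlgebra p)) = Ideal.span {C ((p : ℤ_[p]) ^ k) * L} := by
  obtain ⟨h, hh⟩ := hdvd
  obtain ⟨u, rfl⟩ := hL
  have hfac : ξ * (h * ((u⁻¹ : (IwasawaAlgebra p)ˣ) : IwasawaAlgebra p)) = C ((p : ℤ_[p]) ^ n) := by
    calc ξ * (h * ((u⁻¹ : (IwasawaAlgebra p)ˣ) : IwasawaAlgebra p))
        = (ξ * h) * ((u⁻¹ : (IwasawaAlgebra p)ˣ) : IwasawaAlgebra p) := by ring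
      _ = C ((p : ℤ_[p]) ^ n) * (u : IwasawaAlgebra p) * ((u⁻¹ : (IwasawaAlgebra p)ˣ) : IwasawaAlgebra p) := by
          rw [← hh]
      _ = C ((p : ℤ_[p]) ^ n) := by rw [Units.mul_inv_cancel_right]
  obtain ⟨k, hk, hspan⟩ := exists_span_eq_C_pow_of_mul_eq_C_pow hfac
  refine ⟨k, hk, ?_⟩
  rw [hspan]
  exact (Ideal.span_singleton_mul_right_unit u.isUnit _).symm

end Algebra

/-! ## §2. The characteristic ideal on the parity stratum: `char X^ε = (p^k · ϖ · L_p^ε)` -/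

section Stratum

variable (W : WeierstrassCurve ℚ) [W.IsElliptic] [W.IsGloballyMinimal] (p : ℕ) [Fact p.Prime]

/-- **`char X^ε = (p^k · ϖ · L_p^ε)` at a `(0, ≤ 1)`-certified pair, ANY image, ANY rank.** Let `p` be an odd good
prime of `E = W` with `a_p = 0`, `f₀` the newform of level `N_E`, and suppose Pollack's `L_p^ε` has `μ = 0` and
`λ ≤ 1`. Granted BY NAME Kobayashi Thm. 1.2 (`h12`), Thm. 4.1 (`h41`; ONLY the image-free rational display is
used: `thm41_signedCharIdeal_divisibility.exists_dvd_pow_mul`), the period units (`h5`, `h3`) and `p`-parity (`hpar`):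
for every `(κ, γ, f, ϖ, L^±)` of the binder and every dual datum `D`, `X^ε = D.X` is torsion and
`char X^ε = (g)` with `g^ℚ = ϖ · (p^k · L_p^ε)^ℚ` for some `k : ℕ`. (`λ = 1`: `(L_p^ε) = (T)` by the functional
equation, `T ∣ ξ` by parity, then §1; `λ = 0`: `L_p^ε` is a unit, §1.) CONDITIONAL on the displayed prints.
[cite: Kobayashi2003, Thm. 1.2, Thm. 4.1 (p. 8) and Conjecture (p. 2)] [cite: DokchitserDokchitserAnnals2010, Thm. 1.4]
[cite: Sprung2017, Cor. 4.14 (a_p = 0 display)] [cite: GreenbergVatsal2000, p. 4] -/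
theorem exists_charIdeal_eq_span_C_pow_mul_of_lam_le_one
    (h12 : Kobayashi2003.thm12_signedSelmerDual_finite_torsion)
    (h41 : Kobayashi2003.thm41_signedCharIdeal_divisibility)
    (h5 : realPeriodRat_eq_unit_mul_plusPeriod) (h3 : realPeriodRat_eq_unit_mul_plusPeriod_three)
    (hpar : p_parity W p) (hp : p ≠ 2) (hgood : W.HasGoodReductionAtPrime p) (hap : W.frobeniusTrace p = 0)
    (ε : ℤˣ) [NeZero (W.conductorNorm ℤ)] {f₀ : CuspForm (Gamma0 (W.conductorNorm ℤ)) 2} (hf₀ : IsNewformOf W f₀)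
    (hcert₀ : ∀ L : IwasawaAlgebra p, IsSignedPAdicLFunction f₀ p ε L → mu L = 0 ∧ lam L ≤ 1)
    (κ : ZpExtension ℚ p) (γ : absoluteGaloisGroup ℚ) (hκ : κ.IsCyclotomic) (hγ : κ.IsTopGenerator γ)
    (hγ' : IsCyclotomicVariable p γ) (f : CuspForm (Gamma0 (W.conductorNorm ℤ)) 2) (hf : IsNewformOf W f)
    (ϖ : ℚ) (hϖ : (ϖ : ℝ) * W.realPeriodRat = plusPeriod f)
    (Lplus Lminus : IwasawaAlgebra p) (hPP : IsPollackPair f p Lplus Lminus) (D : SignedSelmerDualData W κ γ ε) :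
    Module.IsTorsion (IwasawaAlgebra p) D.X ∧
      ∃ (k : ℕ) (g : IwasawaAlgebra p), D.charIdeal = Ideal.span {g} ∧
        iwasawaToPowerSeries p g =
          PowerSeries.C (ϖ : ℚ_[p]) * iwasawaToPowerSeries p (C ((p : ℤ_[p]) ^ k) * kobayashiL ε Lplus Lminus) := by
  have hff : f = f₀ := hf.unique hf₀
  subst hff
  haveI : Module.Finite (IwasawaAlgebra p) D.X := h12.moduleFinite hp hgood hap hκ hγ D
  have hX : Module.IsTorsion (IwasawaAlgebra p) D.X := h12.isTorsion hp hgood hap hκ hγ D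
  refine ⟨hX, ?_⟩
  obtain ⟨ξ, hξ⟩ := (charIdeal_isPrincipal_holds p D.X).principal
  have hξ' : D.charIdeal = Ideal.span {ξ} := hξ
  set L := kobayashiL ε Lplus Lminus with hL_def
  have hL : IsSignedPAdicLFunction f p ε L := hPP.isSignedPAdicLFunction_kobayashiL ε
  obtain ⟨hμ, hlam⟩ := hcert₀ L hL
  -- Kato, rational display: `ξ ∣ pⁿ L`
  obtain ⟨n, hn⟩ := h41.exists_dvd_pow_mul hp hgood hap hf hκ hγ hγ' hL D hX hξ'
  have hpn : (p : IwasawaAlgebra p) ^ n = C ((p : ℤ_[p]) ^ n) := by rw [C_pow_eq, map_natCast]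
  rw [hpn] at hn
  -- `(ξ) = (p^k L)` by §1, in either case of the certificate
  obtain ⟨k, -, hspan⟩ : ∃ k ≤ n, Ideal.span ({ξ} : Set (IwasawaAlgebra p)) =
      Ideal.span {C ((p : ℤ_[p]) ^ k) * L} := by
    rcases Nat.le_one_iff_eq_zero_or_eq_one.mp hlam with h0 | h1
    · have hL0 : L ≠ 0 := by
        rw [hL_def, kobayashiL]
        split_ifs
        · exact hPP.2.1
        · exact hPP.1
      exact exists_span_eq_C_pow_mul_of_dvd_of_isUnit hn
        ((isUnit_iff_mu_eq_zero_and_lam_eq_zero L).mpr ⟨hL0, hμ, h0⟩)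
    · have hXξ : (X : IwasawaAlgebra p) ∣ ξ :=
        LargeImageParityStratum.X_dvd_of_charIdeal_eq_span_of_lam_eq_one W p hpar
          cor414_sharpFlat_functionalEquation_apZero_holds hp hgood hap hf hPP ε h1 hγ D hX hξ'
      have hXL : (X : IwasawaAlgebra p) ∣ L :=
        (LargeImageParityStratum.rootNumber_eq_neg_one_and_X_dvd_of_lam_eq_one W p
          cor414_sharpFlat_functionalEquation_apZero_holds hp hgood hap hf hPP ε h1).2
      have hLX : Ideal.span ({L} : Set (IwasawaAlgebra p)) = Ideal.span {X} :=
        (span_eq_span_of_dvd_of_X_dvd_of_lam_eq_one hXL (dvd_refl _) hμ h1).symm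
      exact exists_span_eq_C_pow_mul_of_dvd_of_X_dvd hn hXξ hLX
  -- the period ratio `ϖ` is a `p`-adic unit `u`
  have hirr : W.HasIrreducibleModPGaloisRep p :=
    hasIrreducibleModPGaloisRep_of_dvd_frobeniusTrace W p hp
      (W.not_dvd_minimalDiscriminantInt_of_hasGoodReductionAtPrime' p hgood) (by rw [hap]; exact dvd_zero _)
  have hvϖ : padicValRat p ϖ = 0 := padicValRat_periodRatio_eq_zero h5 h3 W p hp hgood hirr f hf ϖ hϖ
  have hϖ0 : ϖ ≠ 0 := by
    intro h0
    rw [h0, Rat.cast_zero, zero_mul] at hϖ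
    exact (IsNewform0.plusPeriod_pos_holds hf.1 hf.coeffField_eq_bot).ne' hϖ.symm
  obtain ⟨u, hu⟩ := exists_units_coe_eq_ratCast hϖ0 hvϖ
  obtain ⟨hspan', hι⟩ := span_C_units_mul_eq u (C ((p : ℤ_[p]) ^ k) * L)
  refine ⟨k, C (u : ℤ_[p]) * (C ((p : ℤ_[p]) ^ k) * L), ?_, ?_⟩
  · rw [hξ', hspan, hspan']
  · rw [hι, hu]

end Stratum

/-! ## §3. On the stratum, the main conjecture for `ε` ⟺ `μ(ξ^ε) = 0` -/

section MainConjecture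

variable (W : WeierstrassCurve ℚ) [W.IsElliptic] [W.IsGloballyMinimal] (p : ℕ) [Fact p.Prime]

/-- `μ(C(u) · p^k · L) = k` for a unit `u ∈ ℤ_p^×` and `μ(L) = 0`, `L ≠ 0` (private bookkeeping).
[cite: Washington1997, §7.1] -/
private theorem mu_C_units_mul_C_pow_mul {p : ℕ} [Fact p.Prime] (u : ℤ_[p]ˣ) (k : ℕ)
    {L : IwasawaAlgebra p} (hL0 : L ≠ 0) (hμ : mu L = 0) :
    mu (C (u : ℤ_[p]) * (C ((p : ℤ_[p]) ^ k) * L)) = k := by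
  have hCu : IsUnit (C (u : ℤ_[p]) : IwasawaAlgebra p) := (Units.isUnit u).map C
  obtain ⟨hCu0, hmuCu, -⟩ := (isUnit_iff_mu_eq_zero_and_lam_eq_zero _).mp hCu
  have hpk0 : (C ((p : ℤ_[p]) ^ k) : IwasawaAlgebra p) ≠ 0 := C_pow_ne_zero k
  rw [mu_mul hCu0 (mul_ne_zero hpk0 hL0), mu_mul hpk0 hL0, hmuCu, hμ, (mu_C_pow_and_pfree_C_pow k).1]
  ring

/-- **Kobayashi's main conjecture for `(E, p, ε)` at a `(0, ≤ 1)`-certified pair — ANY image, ANY rank — from the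
`μ`-invariant of the signed Selmer group alone.** Hypotheses: `h12 h41 h5 h3 hpar` BY NAME, odd good `p`, `a_p = 0`,
the certificate for the newform of level `N_E`, and `hμX`: for every `(κ, γ)` of the binder and every dual datum,
some characteristic power series `ξ^ε` has `μ(ξ^ε) = 0` (Kobayashi's `μ^ε = 0`; e.g. from Coates–Sujatha's Conjecture
A, companion file). Then `KobayashiMainConjecture W p ε`: by §2 `char X^ε = (u · p^k · L_p^ε)`, and `μ = 0` forces
`k = 0`. CONDITIONAL on the displayed prints + `hμX`; no Kato integrality, no Euler-system engine.
[cite: Kobayashi2003, Thm. 1.2, Thm. 4.1, Thm. 1.4 and Conjecture (p. 2)] [cite: DokchitserDokchitserAnnals2010, Thm. 1.4]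
[cite: GreenbergVatsal2000, p. 4] -/
theorem kobayashiMainConjecture_of_lam_le_one_of_mu_eq_zero
    (h12 : Kobayashi2003.thm12_signedSelmerDual_finite_torsion)
    (h41 : Kobayashi2003.thm41_signedCharIdeal_divisibility)
    (h5 : realPeriodRat_eq_unit_mul_plusPeriod) (h3 : realPeriodRat_eq_unit_mul_plusPeriod_three)
    (hpar : p_parity W p) (hp : p ≠ 2) (hgood : W.HasGoodReductionAtPrime p) (hap : W.frobeniusTrace p = 0)
    (ε : ℤˣ) [NeZero (W.conductorNorm ℤ)] {f₀ : CuspForm (Gamma0 (W.conductorNorm ℤ)) 2} (hf₀ : IsNewformOf W f₀)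
    (hcert₀ : ∀ L : IwasawaAlgebra p, IsSignedPAdicLFunction f₀ p ε L → mu L = 0 ∧ lam L ≤ 1)
    (hμX : ∀ (κ : ZpExtension ℚ p) (γ : absoluteGaloisGroup ℚ), κ.IsCyclotomic → κ.IsTopGenerator γ →
      IsCyclotomicVariable p γ → ∀ (D : SignedSelmerDualData W κ γ ε) (ξ : IwasawaAlgebra p),
        D.charIdeal = Ideal.span {ξ} → mu ξ = 0) :
    KobayashiMainConjecture W p ε := by
  intro κ γ hκ hγ hγ' _ f hf ϖ hϖ Lplus Lminus hPP D
  obtain ⟨hX, k, g, hg, hι⟩ := exists_charIdeal_eq_span_C_pow_mul_of_lam_le_one W p h12 h41 h5 h3 hpar hp hgood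
    hap ε hf₀ hcert₀ κ γ hκ hγ hγ' f hf ϖ hϖ Lplus Lminus hPP D
  refine ⟨hX, ?_⟩
  -- re-derive the explicit generator `C u · (p^k · L)` to read off `μ`
  have hff : f = f₀ := hf.unique hf₀
  subst hff
  set L := kobayashiL ε Lplus Lminus with hL_def
  have hL : IsSignedPAdicLFunction f p ε L := hPP.isSignedPAdicLFunction_kobayashiL ε
  obtain ⟨hμ, -⟩ := hcert₀ L hL
  have hL0 : L ≠ 0 := by
    rw [hL_def, kobayashiL]
    split_ifs
    · exact hPP.2.1
    · exact hPP.1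
  -- `μ(g) = k` since `g^ℚ = ϖ (p^k L)^ℚ` pins `g = C u · p^k · L` for the unit `u` with `u = ϖ`
  have hirr : W.HasIrreducibleModPGaloisRep p :=
    hasIrreducibleModPGaloisRep_of_dvd_frobeniusTrace W p hp
      (W.not_dvd_minimalDiscriminantInt_of_hasGoodReductionAtPrime' p hgood) (by rw [hap]; exact dvd_zero _)
  have hvϖ : padicValRat p ϖ = 0 := padicValRat_periodRatio_eq_zero h5 h3 W p hp hgood hirr f hf ϖ hϖ
  have hϖ0 : ϖ ≠ 0 := by
    intro h0
    rw [h0, Rat.cast_zero, zero_mul] at hϖ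
    exact (IsNewform0.plusPeriod_pos_holds hf.1 hf.coeffField_eq_bot).ne' hϖ.symm
  obtain ⟨u, hu⟩ := exists_units_coe_eq_ratCast hϖ0 hvϖ
  obtain ⟨-, hιu⟩ := span_C_units_mul_eq u (C ((p : ℤ_[p]) ^ k) * L)
  have hgeq : g = C (u : ℤ_[p]) * (C ((p : ℤ_[p]) ^ k) * L) := by
    apply iwasawaToPowerSeries_injective p
    rw [hι, hιu, hu]
  have hk : k = 0 := by
    have := hμX κ γ hκ hγ hγ' D g hg
    rwa [hgeq, mu_C_units_mul_C_pow_mul u k hL0 hμ] at this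
  refine ⟨g, hg, ?_⟩
  rw [hι, hk, pow_zero, map_one, one_mul]

/-- **Conversely, on the stratum the main conjecture forces `μ(ξ^ε) = 0`** for every characteristic power series
`ξ^ε` of every datum (the generator is `ϖ · L_p^ε` up to a unit, and `μ(L_p^ε) = 0`).
[cite: Kobayashi2003, Conjecture (p. 2) and Thm. 1.4] [cite: GreenbergVatsal2000, p. 4] -/
theorem mu_eq_zero_of_kobayashiMainConjecture_of_lam_le_one
    (h5 : realPeriodRat_eq_unit_mul_plusPeriod) (h3 : realPeriodRat_eq_unit_mul_plusPeriod_three)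
    (hp : p ≠ 2) (hgood : W.HasGoodReductionAtPrime p) (hap : W.frobeniusTrace p = 0)
    (ε : ℤˣ) [NeZero (W.conductorNorm ℤ)] {f₀ : CuspForm (Gamma0 (W.conductorNorm ℤ)) 2} (hf₀ : IsNewformOf W f₀)
    (hcert₀ : ∀ L : IwasawaAlgebra p, IsSignedPAdicLFunction f₀ p ε L → mu L = 0 ∧ lam L ≤ 1)
    (hMC : KobayashiMainConjecture W p ε)
    (κ : ZpExtension ℚ p) (γ : absoluteGaloisGroup ℚ) (hκ : κ.IsCyclotomic) (hγ : κ.IsTopGenerator γ)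
    (hγ' : IsCyclotomicVariable p γ) (ϖ : ℚ) (hϖ : (ϖ : ℝ) * W.realPeriodRat = plusPeriod f₀)
    (Lplus Lminus : IwasawaAlgebra p) (hPP : IsPollackPair f₀ p Lplus Lminus)
    (D : SignedSelmerDualData W κ γ ε) (ξ : IwasawaAlgebra p) (hξ : D.charIdeal = Ideal.span {ξ}) :
    mu ξ = 0 := by
  obtain ⟨-, g, hg, hι⟩ := hMC κ γ hκ hγ hγ' f₀ hf₀ ϖ hϖ Lplus Lminus hPP D
  set L := kobayashiL ε Lplus Lminus with hL_def
  have hL : IsSignedPAdicLFunction f₀ p ε L := hPP.isSignedPAdicLFunction_kobayashiL ε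
  obtain ⟨hμ, -⟩ := hcert₀ L hL
  have hL0 : L ≠ 0 := by
    rw [hL_def, kobayashiL]
    split_ifs
    · exact hPP.2.1
    · exact hPP.1
  have hirr : W.HasIrreducibleModPGaloisRep p :=
    hasIrreducibleModPGaloisRep_of_dvd_frobeniusTrace W p hp
      (W.not_dvd_minimalDiscriminantInt_of_hasGoodReductionAtPrime' p hgood) (by rw [hap]; exact dvd_zero _)
  have hvϖ : padicValRat p ϖ = 0 := padicValRat_periodRatio_eq_zero h5 h3 W p hp hgood hirr f₀ hf₀ ϖ hϖ
  have hϖ0 : ϖ ≠ 0 := by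
    intro h0
    rw [h0, Rat.cast_zero, zero_mul] at hϖ
    exact (IsNewform0.plusPeriod_pos_holds hf₀.1 hf₀.coeffField_eq_bot).ne' hϖ.symm
  obtain ⟨u, hu⟩ := exists_units_coe_eq_ratCast hϖ0 hvϖ
  obtain ⟨-, hιu⟩ := span_C_units_mul_eq u L
  have hgeq : g = C (u : ℤ_[p]) * L := by
    apply iwasawaToPowerSeries_injective p
    rw [hι, hιu, hu]
  -- `(ξ) = (g) = (C u · L)`: `ξ = g · unit`, so `μ ξ = μ g = 0`
  have hsp : Ideal.span ({ξ} : Set (IwasawaAlgebra p)) = Ideal.span {g} := by rw [← hξ, hg]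
  obtain ⟨w, hw⟩ := Ideal.span_singleton_eq_span_singleton.mp hsp
  have hCu : IsUnit (C (u : ℤ_[p]) : IwasawaAlgebra p) := (Units.isUnit u).map C
  obtain ⟨hCu0, hmuCu, -⟩ := (isUnit_iff_mu_eq_zero_and_lam_eq_zero _).mp hCu
  obtain ⟨hw0, hmuw, -⟩ := (isUnit_iff_mu_eq_zero_and_lam_eq_zero (↑w⁻¹ : IwasawaAlgebra p)).mp (Units.isUnit _)
  have hg0 : g ≠ 0 := by rw [hgeq]; exact mul_ne_zero hCu0 hL0
  have hξeq : ξ = g * ↑w⁻¹ := by rw [← hw, Units.mul_inv_cancel_right]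
  rw [hξeq, mu_mul hg0 hw0, hmuw, hgeq, mu_mul hCu0 hL0, hmuCu, hμ]

/-- **On the parity stratum, `KobayashiMainConjecture W p ε` ⟺ `μ^ε = 0`** (the `μ`-invariant of a characteristic
power series of every key-`γ` datum vanishes), modulo the prints `h12 h41 h5 h3 hpar` — ANY image, ANY rank. READING
for crux 4: on its `(0, ≤ 1)`-stratum the ONLY non-published input is Kobayashi's `μ^ε = 0`.
[cite: Kobayashi2003, Thm. 1.2, Thm. 4.1, Thm. 1.4 and Conjecture (p. 2)] [cite: DokchitserDokchitserAnnals2010, Thm. 1.4]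
[cite: GreenbergVatsal2000, p. 4] -/
theorem kobayashiMainConjecture_iff_mu_eq_zero_of_lam_le_one
    (h12 : Kobayashi2003.thm12_signedSelmerDual_finite_torsion)
    (h41 : Kobayashi2003.thm41_signedCharIdeal_divisibility)
    (h5 : realPeriodRat_eq_unit_mul_plusPeriod) (h3 : realPeriodRat_eq_unit_mul_plusPeriod_three)
    (hpar : p_parity W p) (hp : p ≠ 2) (hgood : W.HasGoodReductionAtPrime p) (hap : W.frobeniusTrace p = 0)
    (ε : ℤˣ) [NeZero (W.conductorNorm ℤ)] {f₀ : CuspForm (Gamma0 (W.conductorNorm ℤ)) 2} (hf₀ : IsNewformOf W f₀)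
    (hcert₀ : ∀ L : IwasawaAlgebra p, IsSignedPAdicLFunction f₀ p ε L → mu L = 0 ∧ lam L ≤ 1)
    {ϖ : ℚ} (hϖ : (ϖ : ℝ) * W.realPeriodRat = plusPeriod f₀)
    {Lplus Lminus : IwasawaAlgebra p} (hPP : IsPollackPair f₀ p Lplus Lminus) :
    KobayashiMainConjecture W p ε ↔
      ∀ (κ : ZpExtension ℚ p) (γ : absoluteGaloisGroup ℚ), κ.IsCyclotomic → κ.IsTopGenerator γ →
        IsCyclotomicVariable p γ → ∀ (D : SignedSelmerDualData W κ γ ε) (ξ : IwasawaAlgebra p),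
          D.charIdeal = Ideal.span {ξ} → mu ξ = 0 :=
  ⟨fun hMC κ γ hκ hγ hγ' D ξ hξ ↦ mu_eq_zero_of_kobayashiMainConjecture_of_lam_le_one W p h5 h3 hp hgood hap ε hf₀
      hcert₀ hMC κ γ hκ hγ hγ' ϖ hϖ Lplus Lminus hPP D ξ hξ,
    kobayashiMainConjecture_of_lam_le_one_of_mu_eq_zero W p h12 h41 h5 h3 hpar hp hgood hap ε hf₀ hcert₀⟩

end MainConjecture

end Summit.BirchSwinnertonDyer.BirchSwinnertonDyer.Theorems.SmallImageParityStratumExact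

end
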